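import Literature.Analysis.FluidPDE.MildSolutions
import Literature.Analysis.FluidPDE.CriticalSpaces
import Literature.Analysis.FluidPDE.KatoL3Uniqueness
import Literature.Analysis.FunctionSpaces.FourierSobolevNormEmbeddingProofs
import HarnessLib

/-!
# Discharges for `MildSolutions.lean`: `HomSobolev.represents_ofFun` and `fujita_kato_unique`

## Part 1. `ofFun f hf ∈ Ḣ^s` represents `f`: discharge of `HomSobolev.represents_ofFun`

Topic `Analysis/FluidPDE`, namespace `Literature.Analysis.FunctionSpaces.HomSobolev`. Sibling proof file of `MildSolutions.lean`
(which stays untouched; D-0014: a named fact `def X : Prop` is discharged as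
`theorem X_holds : X`). It discharges

* `Literature.HomSobolev.represents_ofFun_holds : represents_ofFun` — for a finite-dimensional real
  inner product space `E` with `dim E ≥ 1`, a complex Hilbert space `F`, `s : ℝ` and a function
  `f : E → F` in `Ḣ^s ∩ L²` (`MemHomSobolev s f`), the element `ofFun f hf` of the bundled
  Fourier-side space `Ḣ^s(E; F) = L²(E, ‖ξ‖^{2s} dξ; F)` (the class of `𝓕f`) *represents* `f`
  in the sense of `HomSobolev.Represents`: for every Schwartz `φ`, both pairings
  `x ↦ 𝓕φ(x) • f(x)` and `ξ ↦ φ(ξ) • g(ξ)` (`g` the stored class) are Lebesgue integrable and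
  `∫ 𝓕φ • f = ∫ φ • g`.

## Source and proof

H. Bahouri, J.-Y. Chemin, R. Danchin, *Fourier Analysis and Nonlinear Partial Differential
Equations*, Grundlehren 343, Springer (2011), Def. 1.31 (the homogeneous space `Ḣ^s(ℝ^d)`:
tempered distributions `u` with `û ∈ L¹_loc` and `∫ |ξ|^{2s} |û(ξ)|² dξ < ∞`) and Prop. 1.34
(`Ḣ^s` is a Hilbert space iff `s < d/2`); the pairing convention `⟨𝓕u, φ⟩ = ⟨u, 𝓕φ⟩` is the
definition of the Fourier transform on `𝓢'` (op. cit., Chap. 1). The book is not held by the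
literature store (`lit want isbn:9783642168291` filed); nothing beyond the definitions is used:
the fact is the `L²` Parseval duality read through `ofFun`, and the proof is

1. (`volume_absolutelyContinuous_homSobolevMeasure`) for `dim E ≥ 1` the weight `‖ξ‖^{2s}` is
   Lebesgue-a.e. nonzero (it vanishes or is infinite only at `ξ = 0`, and `{0}` is null for an
   additive Haar measure on a nontrivial space), so `volume ≪ ‖ξ‖^{2s} dξ`
   (Mathlib `MeasureTheory.withDensity_absolutelyContinuous'`); hence
   (`coeFn_toLp_ofFun_ae_eq`) the representative of the stored `‖ξ‖^{2s} dξ`-class of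
   `ofFun f hf` agrees Lebesgue-a.e. with the `L²` Fourier transform `𝓕f`;
2. (`integral_fourier_smul_eq_integral_smul_fourier_Lp`) `∫ 𝓕φ • g = ∫ φ • 𝓕g` for
   `g ∈ L²` and Schwartz `φ`: this is Mathlib's
   `MeasureTheory.Lp.fourier_toTemperedDistribution_eq` (the `𝓢'`- and `L²`-Fourier transforms
   agree on `L²`) evaluated at `φ`;
3. the two integrability clauses are Hölder `L² × L² → L¹` (`MeasureTheory.MemLp.smul`,
   Schwartz functions are in `L²`), transported along the a.e. equalities of step 1 and
   `MemLp.coeFn_toLp`.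

## Part 2. Uniqueness in the Fujita–Kato class: discharge of `fujita_kato_unique` (ns.S14)

* `Literature.Analysis.FluidPDE.fujita_kato_unique_holds : fujita_kato_unique` — for `ν > 0` and
  `u₀ ∈ Ḣ^{1/2} ∩ L²(ℝ³)`, two unforced mild (duality-form) Navier–Stokes solutions on `[0, T)`
  with datum `u₀`, both in `C([0,T); Ḣ^{1/2} ∩ L²)` and measurable on `(0,T) × ℝ³`, agree a.e.
  at every time `t ∈ [0, T)`.

Source read: P. G. Lemarié-Rieusset, *The Navier–Stokes Problem in the 21st Century* (2016),
§7.4, Thm. 7.4 (mild solutions for `H^{1/2}` data, pp. 128–132) and §7.9, Thm. 7.7 (uniqueness of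
mild solutions in `C([0,T); L³(ℝ³))`, Furioli–Lemarié-Rieusset–Terraneo, pp. 146–150), together
with the Sobolev embedding inequality `Ḣ^δ ⊂ L^{6/(3-2δ)}`, `0 < δ < 3/2` (§7.2, proof of
Lemma 7.3; `δ = 1/2` gives `Ḣ^{1/2} ⊂ L³`), by which the Sobolev class of Thm. 7.4 lies inside the
Lebesgue class of Thm. 7.7. (The locator on the fact itself, Lemarié-Rieusset 2002, Thm. 15.2
(iii), is the first edition of the same material; that edition is not held.) Uniqueness in the
Fujita–Kato class is thus a *corollary* of `L³` uniqueness, and this is exactly the proof given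
here, from results already proved in the tree:

1. (`exists_eLpNorm_three_sub_le_eHomSobolevSeminorm_half`) the critical Sobolev embedding
   `‖f‖_{L³} ≤ C ‖f‖_{Ḣ^{1/2}}` on `L²(ℝ³)` (Bahouri–Chemin–Danchin 2011, Thm. 1.38; proved as
   `Literature.Analysis.FunctionSpaces.eLpNorm_three_le_eHomSobolevSeminorm_half_holds`), transported to real vector
   fields and their differences through the `ℝ`-linear isometry `EuclideanSpace.complexify`;
2. (`ContinuousInHomSobolevOn.continuousInLpOn_three`) hence `C(S; Ḣ^{1/2} ∩ L²) ⊂ C(S; L³)`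
   (slices by `memLp_three_of_memHomSobolev_half`, moduli of continuity by step 1 and a squeeze),
   and `u₀ ∈ L³`;
3. `kato_unique_holds` (`KatoL3Uniqueness.lean`; Furioli–Lemarié-Rieusset–Terraneo 2000, Thm. 1 =
   Lemarié-Rieusset 2016, Thm. 7.7) concludes.

## References

* [LemarieRieusset2016] P. G. Lemarié-Rieusset, The Navier–Stokes Problem in the 21st Century,
  CRC Press (2016), §7.4 Thm. 7.4, §7.9 Thm. 7.7, doi:10.1201/b19556.
* [FurioliLemarierieussetTerraneo2000] G. Furioli, P. G. Lemarié-Rieusset, E. Terraneo, Unicité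
  dans `L³(ℝ³)` et d'autres espaces fonctionnels limites pour Navier–Stokes, Rev. Mat. Iberoam. 16
  (2000), 605–667, Thm. 1.
* [BahouriCheminDanchin2011] H. Bahouri, J.-Y. Chemin, R. Danchin, Fourier Analysis and
  Nonlinear Partial Differential Equations, Grundlehren der mathematischen Wissenschaften 343,
  Springer (2011), Def. 1.31, Prop. 1.34, doi:10.1007/978-3-642-16830-7.
-/

noncomputable section

open MeasureTheory Filter FourierTransform
open scoped ENNReal SchwartzMap

namespace Literature.Analysis.FluidPDE

section HomSobolev
open Literature.Analysis.FunctionSpaces (HomSobolev)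
open Literature.Analysis.FunctionSpaces.HomSobolev

variable {E F : Type*} [NormedAddCommGroup E] [InnerProductSpace ℝ E] [FiniteDimensional ℝ E]
  [MeasurableSpace E] [BorelSpace E] [NormedAddCommGroup F] [InnerProductSpace ℂ F]
  [CompleteSpace F]

omit [NormedAddCommGroup F] [InnerProductSpace ℂ F] [CompleteSpace F] in
/-- For `dim E ≥ 1`, Lebesgue measure is absolutely continuous with respect to the Fourier-side
weight measure `‖ξ‖^{2s} dξ` of `Ḣ^s`: the density vanishes (or is infinite) only at `ξ = 0`,
a Lebesgue-null set (Bahouri–Chemin–Danchin 2011, Def. 1.31; Mathlib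
`MeasureTheory.withDensity_absolutelyContinuous'`).
[cite: BahouriCheminDanchin2011, Def. 1.31] -/
theorem _root_.Literature.Analysis.FunctionSpaces.HomSobolev.volume_absolutelyContinuous_homSobolevMeasure (hE : 0 < Module.finrank ℝ E) (s : ℝ) :
    (volume : Measure E) ≪ FunctionSpaces.homSobolevMeasure E s := by
  haveI : Nontrivial E := Module.nontrivial_of_finrank_pos hE
  rw [FunctionSpaces.homSobolevMeasure_def]
  refine withDensity_absolutelyContinuous'
    (ENNReal.continuous_rpow_const.measurable.comp measurable_enorm).aemeasurable ?_
  filter_upwards [Measure.ae_ne (volume : Measure E) 0] with ξ hξ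
  have h0 : (‖ξ‖ₑ : ℝ≥0∞) ≠ 0 := by simpa using hξ
  have htop : (‖ξ‖ₑ : ℝ≥0∞) ≠ ∞ := enorm_ne_top
  simp [ENNReal.rpow_eq_zero_iff, h0, htop]

omit [NormedAddCommGroup F] [InnerProductSpace ℂ F] [CompleteSpace F] in
/-- Consequently a `‖ξ‖^{2s} dξ`-a.e. equality is a Lebesgue-a.e. equality (`dim E ≥ 1`)
(Bahouri–Chemin–Danchin 2011, Def. 1.31). [cite: BahouriCheminDanchin2011, Def. 1.31] -/
theorem _root_.Literature.Analysis.FunctionSpaces.HomSobolev.ae_eq_volume_of_ae_eq_homSobolevMeasure (hE : 0 < Module.finrank ℝ E) {s : ℝ}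
    {G : Type*} {g g' : E → G} (h : g =ᵐ[FunctionSpaces.homSobolevMeasure E s] g') :
    g =ᵐ[(volume : Measure E)] g' :=
  (volume_absolutelyContinuous_homSobolevMeasure hE s).ae_eq h

/-- The stored class of `ofFun f hf` is Lebesgue-a.e. the `L²` Fourier transform of `f`
(`dim E ≥ 1`; Bahouri–Chemin–Danchin 2011, Def. 1.31).
[cite: BahouriCheminDanchin2011, Def. 1.31] -/
theorem _root_.Literature.Analysis.FunctionSpaces.HomSobolev.coeFn_toLp_ofFun_ae_eq (hE : 0 < Module.finrank ℝ E) {s : ℝ} (f : E → F)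
    (hf : FunctionSpaces.MemHomSobolev s f) :
    ((toLp s (ofFun f hf) : Lp F 2 (FunctionSpaces.homSobolevMeasure E s)) : E → F) =ᵐ[(volume : Measure E)]
      ((𝓕 (hf.choose.toLp f) : Lp F 2 (volume : Measure E)) : E → F) := by
  have hco : toLp s (ofFun f hf) = hf.choose_spec.toLp _ := (toLp s).apply_symm_apply _
  rw [hco]
  exact ae_eq_volume_of_ae_eq_homSobolevMeasure hE (MemLp.coeFn_toLp _)

/-- Parseval duality between a Schwartz function and an `L²` function:
`∫ 𝓕φ • g = ∫ φ • 𝓕g`, i.e. the `L²` (Fourier–Plancherel) transform of `g` is its Fourier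
transform as a tempered distribution. This is Mathlib's
`MeasureTheory.Lp.fourier_toTemperedDistribution_eq` evaluated at `φ` (textbook: the
extensions of `𝓕` from `𝓢` to `𝓢'` and to `L²`, e.g. Bahouri–Chemin–Danchin 2011, Chap. 1).
[folklore] -/
theorem _root_.Literature.Analysis.FunctionSpaces.HomSobolev.integral_fourier_smul_eq_integral_smul_fourier_Lp (φ : 𝓢(E, ℂ))
    (g : Lp F 2 (volume : Measure E)) :
    ∫ x, (𝓕 φ) x • (g : E → F) x =
      ∫ ξ, φ ξ • ((𝓕 g : Lp F 2 (volume : Measure E)) : E → F) ξ := by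
  have key := congrArg (fun u : 𝓢'(E, F) => u φ) (Lp.fourier_toTemperedDistribution_eq g)
  simpa only [TemperedDistribution.fourier_apply, Lp.toTemperedDistribution_apply] using key

/-- **Discharge** of `represents_ofFun`: for `f ∈ Ḣ^s ∩ L²` and `dim E ≥ 1`, the element
`ofFun f hf ∈ Ḣ^s` represents `f` (Bahouri–Chemin–Danchin 2011, Def. 1.31; proof: Hölder
`L² × L² → L¹` for the two integrability clauses, Mathlib's
`MeasureTheory.Lp.fourier_toTemperedDistribution_eq` for the pairing identity, and
`volume ≪ ‖ξ‖^{2s} dξ` to read the stored class Lebesgue-a.e.).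
[cite: BahouriCheminDanchin2011, Def. 1.31] -/
theorem _root_.Literature.Analysis.FunctionSpaces.HomSobolev.represents_ofFun_holds : represents_ofFun (E := E) (F := F) := by
  intro s hE f hf
  set f₂ : Lp F 2 (volume : Measure E) := hf.choose.toLp f with hf₂
  have hff : (f₂ : E → F) =ᵐ[(volume : Measure E)] f := hf.choose.coeFn_toLp
  have hrep : ((toLp s (ofFun f hf) : Lp F 2 (FunctionSpaces.homSobolevMeasure E s)) : E → F)
      =ᵐ[(volume : Measure E)] ((𝓕 f₂ : Lp F 2 (volume : Measure E)) : E → F) :=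
    coeFn_toLp_ofFun_ae_eq hE f hf
  refine ⟨fun φ => ?_, fun φ => ?_, fun φ => ?_⟩
  · have h1 : MemLp (fun x => (𝓕 φ) x • (f₂ : E → F) x) 1 (volume : Measure E) :=
      (Lp.memLp f₂).smul ((𝓕 φ).memLp 2 (volume : Measure E))
    exact (memLp_one_iff_integrable.1 h1).congr
      (by filter_upwards [hff] with x hx; simp [hx])
  · have h1 :
        MemLp (fun ξ => φ ξ • ((𝓕 f₂ : Lp F 2 (volume : Measure E)) : E → F) ξ) 1
          (volume : Measure E) :=
      (Lp.memLp _).smul (φ.memLp 2 (volume : Measure E))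
    exact (memLp_one_iff_integrable.1 h1).congr
      (by filter_upwards [hrep] with x hx; simp [hx])
  · calc ∫ x, (𝓕 φ) x • f x = ∫ x, (𝓕 φ) x • (f₂ : E → F) x :=
          integral_congr_ae (by filter_upwards [hff] with x hx; simp [hx])
      _ = ∫ ξ, φ ξ • ((𝓕 f₂ : Lp F 2 (volume : Measure E)) : E → F) ξ :=
          integral_fourier_smul_eq_integral_smul_fourier_Lp φ f₂
      _ = ∫ ξ, φ ξ •
            ((toLp s (ofFun f hf) : Lp F 2 (FunctionSpaces.homSobolevMeasure E s)) : E → F) ξ :=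
          integral_congr_ae (by filter_upwards [hrep] with x hx; simp [hx])

end HomSobolev

/-! ## Part 2: uniqueness in `C([0,T); Ḣ^{1/2} ∩ L²)` from uniqueness in `C([0,T); L³)` -/

section FujitaKatoUnique

open Set Function Topology
open scoped NNReal

open FunctionSpaces.EuclideanSpace (complexify norm_complexify)

/-- **Critical embedding for differences of real fields.** There is `C` such that for all
`f, g : ℝ³ → ℝ³` whose complexifications are in `L²`,
`‖f - g‖_{L³} ≤ C ‖f - g‖_{Ḣ^{1/2}}` (the `Ḣ^{1/2}` seminorm of `complexify ∘ (f - g)`). This is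
the proved embedding `Ḣ^{1/2}(ℝ³) ⊂ L³(ℝ³)` (Bahouri–Chemin–Danchin 2011, Thm. 1.38 with `d = 3`,
`s = 1/2`; `Literature.Analysis.FunctionSpaces.eLpNorm_three_le_eHomSobolevSeminorm_half_holds`)
read through the `ℝ`-linear isometry `complexify` (`‖complexify v‖ = ‖v‖`,
`complexify (v - w) = complexify v - complexify w`).
[cite: BahouriCheminDanchin2011, Thm. 1.38] -/
theorem exists_eLpNorm_three_sub_le_eHomSobolevSeminorm_half :
    ∃ C : ℝ≥0, ∀ f g : EuclideanSpace ℝ (Fin 3) → EuclideanSpace ℝ (Fin 3),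
      MemLp (complexify ∘ f) 2 volume → MemLp (complexify ∘ g) 2 volume →
        eLpNorm (f - g) 3 volume ≤
          C * Function.eHomSobolevSeminorm (1 / 2 : ℝ) (complexify ∘ (f - g)) := by
  obtain ⟨C, hC⟩ :=
    @FunctionSpaces.eLpNorm_three_le_eHomSobolevSeminorm_half_holds
      (EuclideanSpace ℂ (Fin 3)) _ _ _
  refine ⟨C, fun f g hf hg => ?_⟩
  have hsub : (complexify ∘ (f - g) : EuclideanSpace ℝ (Fin 3) → EuclideanSpace ℂ (Fin 3)) =
      complexify ∘ f - complexify ∘ g := by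
    funext x
    simp only [Function.comp_apply, Pi.sub_apply, map_sub]
  have h2 : MemLp (complexify ∘ (f - g)) 2 volume := by
    rw [hsub]
    exact hf.sub hg
  have hnorm : eLpNorm (f - g) 3 volume = eLpNorm (complexify ∘ (f - g)) 3 volume :=
    eLpNorm_congr_norm_ae (Eventually.of_forall fun x => (norm_complexify ((f - g) x)).symm)
  rw [hnorm]
  exact hC _ h2

/-- **`C(S; Ḣ^{1/2} ∩ L²) ⊂ C(S; L³)`** for real vector fields on `ℝ³`: a field continuous in
time with values in `Ḣ^{1/2} ∩ L²` (`ContinuousInHomSobolevOn S (1/2)`) is continuous in time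
with values in `L³` (`ContinuousInLpOn S 3`). Slices: `Ḣ^{1/2} ∩ L² ⊂ L³`
(`memLp_three_of_memHomSobolev_half`); moduli of continuity:
`‖u t - u t₀‖_{L³} ≤ C ‖u t - u t₀‖_{Ḣ^{1/2}} → 0`
(`exists_eLpNorm_three_sub_le_eHomSobolevSeminorm_half`). This is the Sobolev embedding
inequality `Ḣ^δ(ℝ³) ⊂ L^{6/(3-2δ)}`, `0 < δ < 3/2`, of Lemarié-Rieusset 2016, §7.2 (proof of
Lemma 7.3), at `δ = 1/2`, which places the Sobolev class `C([0,T]; H^{1/2})` of Thm. 7.4 inside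
the Lebesgue class `C([0,T); L³)` of Thm. 7.7.
[cite: LemarieRieusset2016, §7.2 Lemma 7.3 (proof, Sobolev embedding) and §7.4 Thm. 7.4] -/
theorem ContinuousInHomSobolevOn.continuousInLpOn_three {S : Set ℝ}
    {u : ℝ → EuclideanSpace ℝ (Fin 3) → EuclideanSpace ℝ (Fin 3)}
    (hu : ContinuousInHomSobolevOn S (1 / 2 : ℝ) u) : ContinuousInLpOn S 3 u := by
  obtain ⟨C, hC⟩ := exists_eLpNorm_three_sub_le_eHomSobolevSeminorm_half
  refine ⟨fun t ht => memLp_three_of_memHomSobolev_half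
    FunctionSpaces.eLpNorm_three_le_eHomSobolevSeminorm_half_holds (hu.1 t ht), fun t₀ ht₀ => ?_⟩
  have h2 : ∀ t ∈ S, MemLp (complexify ∘ u t) 2 volume := fun t ht => (hu.1 t ht).fst
  have hlim : Tendsto (fun t => (C : ℝ≥0∞) *
      Function.eHomSobolevSeminorm (1 / 2 : ℝ) (complexify ∘ (u t - u t₀))) (𝓝[S] t₀) (𝓝 0) := by
    simpa only [mul_zero] using
      ENNReal.Tendsto.const_mul (hu.2 t₀ ht₀) (Or.inr ENNReal.coe_ne_top)
  refine tendsto_of_tendsto_of_tendsto_of_le_of_le' tendsto_const_nhds hlim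
    (Eventually.of_forall fun _ => zero_le) ?_
  filter_upwards [self_mem_nhdsWithin] with t ht
  exact hC (u t) (u t₀) (h2 t ht) (h2 t₀ ht₀)

/-- **Discharge of ns.S14 `fujita_kato_unique`** (uniqueness in `C([0,T); Ḣ^{1/2} ∩ L²)`;
Fujita–Kato 1964, Thm. 3.2; Lemarié-Rieusset 2016, §7.4 Thm. 7.4 with §7.9 Thm. 7.7). For
`ν > 0` and `u₀ ∈ Ḣ^{1/2} ∩ L²(ℝ³)`, two unforced mild solutions on `[0, T)` with datum `u₀`,
both in `C([0,T); Ḣ^{1/2} ∩ L²)` and measurable on `(0,T) × ℝ³`, agree a.e. at every time.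
Proof, as printed (reduction of the Sobolev class to the Lebesgue class): `u₀ ∈ L³`
(`memLp_three_of_memHomSobolev_half` and the proved embedding
`eLpNorm_three_le_eHomSobolevSeminorm_half_holds`), `u, v ∈ C([0,T); L³)`
(`ContinuousInHomSobolevOn.continuousInLpOn_three`), then uniqueness in `C([0,T); L³)`,
the proved `kato_unique_holds` (Furioli–Lemarié-Rieusset–Terraneo 2000, Thm. 1 =
Lemarié-Rieusset 2016, Thm. 7.7). The `L²`-continuity hypotheses of the fact are not needed.
[cite: LemarieRieusset2016, §7.9 Thm. 7.7 (pp. 146–150) with §7.4 Thm. 7.4 (pp. 128–132)] -/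
theorem fujita_kato_unique_holds : fujita_kato_unique := by
  intro ν T hν u₀ u v hu₀ hu hv huc _huc₂ hvc _hvc₂ hmu hmv
  exact kato_unique_holds hν
    (memLp_three_of_memHomSobolev_half
      FunctionSpaces.eLpNorm_three_le_eHomSobolevSeminorm_half_holds hu₀)
    hu hv huc.continuousInLpOn_three hvc.continuousInLpOn_three hmu hmv

end FujitaKatoUnique

end Literature.Analysis.FluidPDE
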